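import Summits.ValiantsHypothesis.ValiantsHypothesis.Theorems.SymPencilPerFourOneRowToricTools

/-!
# Route `SymPencil` — leaf R1N of the `(11, 5, 4)` cascade, §6.6 TORIC branch, product case `(2, 2, 1)` — conclusion
# (`--supports` stmt-ValiantsHypothesis-5674 `SdcSuperquadratic`; memo `SING-FIVE-CLASSIFICATION.md` §6.6 (T-prod), for the
# residual `stub_R1N_residual` (`R1NToric K`) of `Cruxes/SdcSuperquadratic/Lines/sing_five_classification.lean`; rung currency only)

`toric_prod_absurd` (see `SymPencilPerFourOneRowToricTools` for the plan and the tools `caseI`, `finrank_le_one_of_permOrth`,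
`dep_of_minors`, `T3_single_mid`): with zero row `0`, `dim W = 5`, `Sing3`, no zero column, a per-direction family of `≤ 4`
squares at every element, and live rows of ranks `(2, 2, 1)`, the space `W = A × B × K c₀` is impossible — some `b₁ ∈ B`
and `a₁ ∈ A` are not perm-orthogonal to `c₀`, so `T3 (A,A,c₀) = T3 (B,B,c₀) = 0` and `T3 (A,A,B) = 0` (✓ `caseI`); if
`B ⊄ A` the `3`-space `A + K b` makes `B ⊥ c₀` (✓ `permOrth_of_T3_hyperplane`), else `A = B`, `T3 ≡ 0` on `A³`, the toric
triple lemma gives two common zero coordinates `p, q`, `c₀(q) ≠ 0` by the column hypothesis, and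
`T3 (a, a, c₀)_p = 2 c₀(q) a_{p'} a_{q'}` leaves `dim A ≤ 1`.

Honest framing: [folklore] linear algebra for ONE sub-case of ONE leaf of ONE of four open size-27 cells; leaf R1N and the cell
file remain OPEN until the wiring lands; `27 ≤ sdc(per₄) ≤ 29` unchanged; the crux `SdcSuperquadratic` and `VP ≠ VNP` untouched;
no summit statement is proved here.  No definitions, no named facts.
-/

noncomputable section

set_option linter.dupNamespace false

namespace Summit.ValiantsHypothesis.ValiantsHypothesis.Theorems.SymPencilPerFourOneRowToric

open Module MvPolynomial
open Literature.Computability.AlgebraicComplexity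
open Summit.ValiantsHypothesis.ValiantsHypothesis.Theorems.SymPencilSingSixClassification
open Summit.ValiantsHypothesis.ValiantsHypothesis.Theorems.SymPencilPerFourOneRowKernelPlane
open Summit.ValiantsHypothesis.ValiantsHypothesis.Theorems.SymPencilPerFourOneRowReading

variable {K : Type*} [Field K]

/-! ## 3. The product case of the toric branch -/

/-- **§6.6 (T-prod): live rows of ranks `(2, 2, 1)` are impossible.**  See the module docstring. [folklore] -/
theorem toric_prod_absurd [CharZero K] {W : Submodule K (Fin 4 × Fin 4 → K)} (hS : Sing3 W)
    (h5 : finrank K W = 5) (hi : ∀ y ∈ W, row y 0 = 0)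
    (hcol : ∀ m, ∃ y ∈ W, ∃ x, y (x, m) ≠ 0)
    (hP : ∀ y ∈ W, ∃ (c : Fin 4 → K) (Λ : Fin 4 → ((Fin 4 × Fin 4 → K) →ₗ[K] K)),
      ∀ u : Fin 4 × Fin 4 → K, ∃ e₀ e₁ : K, ∀ s : K,
        eval (u + s • y) (perPoly (Fin 4) K) = e₀ + s * e₁ + s ^ 2 * ∑ k, c k * (Λ k u) ^ 2)
    (hn1 : finrank K (W.map (rowL 1)) = 2) (hn2 : finrank K (W.map (rowL 2)) = 2)
    (hn3 : finrank K (W.map (rowL 3)) = 1) : False := by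
  classical
  set A1 := W.map (rowL 1) with hA1_def
  set A2 := W.map (rowL 2) with hA2_def
  set A3 := W.map (rowL 3) with hA3_def
  -- row embeddings (as in `toric_hyp_absurd`)
  let Em : Fin 4 → (Fin 4 → K) →ₗ[K] (Fin 4 × Fin 4 → K) := fun x =>
    LinearMap.pi fun p => if p.1 = x then LinearMap.proj p.2 else 0
  have hEm : ∀ x a p, Em x a p = if p.1 = x then a p.2 else 0 := by
    intro x a p
    simp only [Em, LinearMap.pi_apply]
    split_ifs <;> simp
  have rowEm : ∀ x x' a, row (Em x a) x' = if x' = x then a else 0 := by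
    intro x x' a
    by_cases h : x' = x
    · rw [if_pos h]; funext j; simp [row, hEm, h]
    · rw [if_neg h]; funext j; simp [row, hEm, h]
  have rowE : ∀ a b c : Fin 4 → K,
      row (Em 1 a + Em 2 b + Em 3 c) 0 = 0 ∧ row (Em 1 a + Em 2 b + Em 3 c) 1 = a ∧
      row (Em 1 a + Em 2 b + Em 3 c) 2 = b ∧ row (Em 1 a + Em 2 b + Em 3 c) 3 = c := by
    intro a b c
    refine ⟨?_, ?_, ?_, ?_⟩ <;> simp [row_add, rowEm]
  -- the product `P = {row 0 = 0, row x ∈ A_x}` equals `W`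
  set P : Submodule K (Fin 4 × Fin 4 → K) := LinearMap.ker (rowL 0) ⊓
    (A1.comap (rowL 1) ⊓ (A2.comap (rowL 2) ⊓ A3.comap (rowL 3))) with hP_def
  have hmemP : ∀ y, y ∈ P ↔ row y 0 = 0 ∧ row y 1 ∈ A1 ∧ row y 2 ∈ A2 ∧ row y 3 ∈ A3 := fun y => by
    simp only [hP_def, Submodule.mem_inf, LinearMap.mem_ker, Submodule.mem_comap, rowL_apply]
  have hWP : W ≤ P := fun y hy => (hmemP y).2
    ⟨hi y hy, Submodule.mem_map_of_mem hy, Submodule.mem_map_of_mem hy, Submodule.mem_map_of_mem hy⟩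
  have hP5 : finrank K P ≤ 5 := by
    have c1 := finrank_kernel_add P 1
    have c2 := finrank_kernel_add (P ⊓ LinearMap.ker (rowL 1)) 2
    have c3 := finrank_kernel_add (P ⊓ LinearMap.ker (rowL 1) ⊓ LinearMap.ker (rowL 2)) 3
    have m1 : finrank K (P.map (rowL 1)) ≤ 2 := by
      rw [← hn1]
      apply Submodule.finrank_mono
      rintro _ ⟨y, hy, rfl⟩
      exact ((hmemP y).1 hy).2.1
    have m2 : finrank K ((P ⊓ LinearMap.ker (rowL 1)).map (rowL 2)) ≤ 2 := by
      rw [← hn2]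
      apply Submodule.finrank_mono
      rintro _ ⟨y, hy, rfl⟩
      exact ((hmemP y).1 (Submodule.mem_inf.1 hy).1).2.2.1
    have m3 : finrank K ((P ⊓ LinearMap.ker (rowL 1) ⊓ LinearMap.ker (rowL 2)).map (rowL 3)) ≤ 1 := by
      rw [← hn3]
      apply Submodule.finrank_mono
      rintro _ ⟨y, hy, rfl⟩
      exact ((hmemP y).1 (Submodule.mem_inf.1 (Submodule.mem_inf.1 hy).1).1).2.2.2
    have m4 : finrank K ↥(P ⊓ LinearMap.ker (rowL 1) ⊓ LinearMap.ker (rowL 2) ⊓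
        LinearMap.ker (rowL 3)) = 0 := by
      rw [Submodule.finrank_eq_zero]
      rw [eq_bot_iff]
      intro y hy
      rw [Submodule.mem_bot]
      have hy3 := (Submodule.mem_inf.1 hy).2
      have hy12 := (Submodule.mem_inf.1 hy).1
      have hy2 := (Submodule.mem_inf.1 hy12).2
      have hyP1 := (Submodule.mem_inf.1 hy12).1
      have hy1 := (Submodule.mem_inf.1 hyP1).2
      have hyP := (Submodule.mem_inf.1 hyP1).1
      rw [LinearMap.mem_ker, rowL_apply] at hy1 hy2 hy3
      have hy0 := ((hmemP y).1 hyP).1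
      funext ⟨i, j⟩
      fin_cases i
      · exact congr_fun hy0 j
      · exact congr_fun hy1 j
      · exact congr_fun hy2 j
      · exact congr_fun hy3 j
    omega
  have hPW : P = W := (Submodule.eq_of_le_of_finrank_le hWP (by omega)).symm
  have hmemW : ∀ a ∈ A1, ∀ b ∈ A2, ∀ c ∈ A3, Em 1 a + Em 2 b + Em 3 c ∈ W := by
    intro a ha b hb c hc
    rw [← hPW]
    obtain ⟨h0, h1, h2, h3⟩ := rowE a b c
    exact (hmemP _).2 ⟨h0, by rw [h1]; exact ha, by rw [h2]; exact hb, by rw [h3]; exact hc⟩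
  -- the generator `c₀` of `A3`
  have hA3ne : A3 ≠ ⊥ := fun h => by
    rw [h, finrank_bot] at hn3
    exact zero_ne_one hn3
  obtain ⟨c₀, hc₀, hc₀0⟩ := Submodule.exists_mem_ne_zero_of_ne_bot hA3ne
  have hspan : (K ∙ c₀) = A3 :=
    Submodule.eq_of_le_of_finrank_le ((Submodule.span_singleton_le_iff_mem _ _).2 hc₀)
      (by rw [finrank_span_singleton hc₀0, hn3])
  -- `T3 (a, b, c₀) = 0` and the three-row reading at `(a; b; c₀)`
  have hT : ∀ a ∈ A1, ∀ b ∈ A2, ∀ l, T3 a b c₀ l = 0 := by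
    intro a ha b hb l
    have h' := T3_eq_zero_of_sing3 hS (hmemW a ha b hb c₀ hc₀) 1 2 3 (by decide) (by decide) (by decide) l
    obtain ⟨-, h1, h2, h3⟩ := rowE a b c₀
    rwa [h1, h2, h3] at h'
  have hD : ∀ a ∈ A1, ∀ b ∈ A2, ∀ (I : Fin 3 → Fin 4) (J : Fin 3 → Fin 3 × Fin 4),
      ((Matrix.of fun (l : Fin 4) (p : Fin 3 × Fin 4) =>
        ![T3 (Pi.single p.2 1) b c₀ l, T3 a (Pi.single p.2 1) c₀ l, T3 a b (Pi.single p.2 1) l] p.1).submatrix I J).det = 0 := by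
    intro a ha b hb I J
    obtain ⟨c, Λ, h⟩ := hP _ (hmemW a ha b hb c₀ hc₀)
    obtain ⟨h0, h1, h2, h3⟩ := rowE a b c₀
    have hm := minors_three_rows (ι := Fin 4) (by simp) (Em 1 a + Em 2 b + Em 3 c₀)
      (fun m => congr_fun h0 m) c Λ h I J
    simp only [h1, h2, h3] at hm
    exact hm
  have hT' : ∀ b ∈ A2, ∀ a ∈ A1, ∀ l, T3 b a c₀ l = 0 := fun b hb a ha l => by
    rw [T3_swap₁₂]; exact hT a ha b hb l
  have hD' : ∀ b ∈ A2, ∀ a ∈ A1, ∀ (I : Fin 3 → Fin 4) (J : Fin 3 → Fin 3 × Fin 4),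
      ((Matrix.of fun (l : Fin 4) (p : Fin 3 × Fin 4) =>
        ![T3 (Pi.single p.2 1) a c₀ l, T3 b (Pi.single p.2 1) c₀ l, T3 b a (Pi.single p.2 1) l] p.1).submatrix I J).det = 0 := by
    intro b hb a ha I J
    let J' : Fin 3 → Fin 3 × Fin 4 := fun t => (Equiv.swap (0 : Fin 3) 1 (J t).1, (J t).2)
    rw [← hD a ha b hb I J']
    congr 1
    ext t t'
    simp only [Matrix.submatrix_apply, Matrix.of_apply, J']
    have hx : ∀ (x : Fin 3) (m : Fin 4),
        ![T3 (Pi.single m 1) a c₀ (I t), T3 b (Pi.single m 1) c₀ (I t), T3 b a (Pi.single m 1) (I t)] x =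
        ![T3 (Pi.single m 1) b c₀ (I t), T3 a (Pi.single m 1) c₀ (I t), T3 a b (Pi.single m 1) (I t)]
          (Equiv.swap (0 : Fin 3) 1 x) := by
      intro x m
      fin_cases x
      · simp [T3_swap₁₂]
      · simp [Equiv.swap_apply_right, T3_swap₁₂]
      · simp [Equiv.swap_apply_of_ne_of_ne, T3_swap₁₂]
    exact hx (J t').1 (J t').2
  -- non-perm-orthogonal elements exist on both sides
  have hB : ∃ b₁ ∈ A2, ¬ PermOrth b₁ c₀ := by
    by_contra hne
    push Not at hne
    have := finrank_le_one_of_permOrth A2 hc₀0 hne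
    omega
  have hA : ∃ a₁ ∈ A1, ¬ PermOrth a₁ c₀ := by
    by_contra hne
    push Not at hne
    have := finrank_le_one_of_permOrth A1 hc₀0 hne
    omega
  obtain ⟨b₁, hb₁, hnb₁⟩ := hB
  obtain ⟨a₁, ha₁, hna₁⟩ := hA
  obtain ⟨h5a, -⟩ := caseI A1 A2 c₀ hT hD hb₁ hnb₁
  obtain ⟨h5a', -⟩ := caseI A2 A1 c₀ hT' hD' ha₁ hna₁
  have h5b : ∀ a ∈ A1, ∀ a' ∈ A1, ∀ b ∈ A2, ∀ m, T3 a' a b m = 0 := by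
    intro a ha a' ha' b hb m
    by_cases hpb : PermOrth b c₀
    · have hnb : ¬ PermOrth (b + b₁) c₀ := fun h => hnb₁ (by
        have h' := permOrth_sub h hpb
        rwa [add_sub_cancel_left] at h')
      have h := (caseI A1 A2 c₀ hT hD (A2.add_mem hb hb₁) hnb).2 a ha a' ha' m
      rw [T3_add₃, (caseI A1 A2 c₀ hT hD hb₁ hnb₁).2 a ha a' ha' m, add_zero] at h
      exact h
    · exact (caseI A1 A2 c₀ hT hD hb hpb).2 a ha a' ha' m
  by_cases hBA : A2 ≤ A1
  · -- `A2 = A1 =: A`: `T3 ≡ 0` on `A × A × A`, two common zero coordinates, `dim A ≤ 1`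
    have hEq : A2 = A1 := Submodule.eq_of_le_of_finrank_le hBA (by rw [hn1, hn2])
    have hAAA : ∀ a ∈ A1, ∀ a' ∈ A1, ∀ a'' ∈ A1, ∀ l, T3 a a' a'' l = 0 := by
      intro a ha a' ha' a'' ha'' l
      exact h5b a' ha' a ha a'' (hEq ▸ ha'') l
    obtain ⟨p, q, hpq, hApq, -, -⟩ := toricTriple permOrthPairs A1 A1 A1 hn1 hn1 hn1 hAAA
    have hcne : ∀ k, (∀ a ∈ A1, a k = 0) → c₀ k ≠ 0 := by
      intro k hk h0
      obtain ⟨y, hy, x, hne⟩ := hcol k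
      obtain ⟨hy0, hy1, hy2, hy3⟩ := (hmemP y).1 (hWP hy)
      apply hne
      fin_cases x
      · exact congr_fun hy0 k
      · exact hk _ hy1
      · exact hk _ (hEq ▸ hy2)
      · rw [← hspan, Submodule.mem_span_singleton] at hy3
        obtain ⟨μ, hμ⟩ := hy3
        have h := congr_fun hμ k
        simp only [Pi.smul_apply, smul_eq_mul, h0, mul_zero] at h
        exact h.symm
    have hcq : c₀ q ≠ 0 := hcne q fun a ha => (hApq a ha).2
    obtain ⟨p', q', hp'q', hp'p, hp'q, hq'p, hq'q, hcov⟩ := exists_compl_pair_cover p q hpq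
    have hpp : ∀ a ∈ A1, a p' * a q' = 0 := by
      intro a ha
      have h := h5a a ha a ha p
      rw [T3_swap₂₃, T3_border q p hpq a c₀ a (hApq a ha).2 (hApq a ha).2,
        T3_single_mid a a p q p' q' hpq hp'p hp'q hq'p hq'q hp'q'] at h
      have h2 : c₀ q * (2 * (a p' * a q')) = 0 := by linear_combination h
      exact (mul_eq_zero.1 ((mul_eq_zero.1 h2).resolve_left hcq)).resolve_left two_ne_zero
    -- three common zero coordinates leave `dim A ≤ 1`
    have hle1 : ∀ k k' : Fin 4, (∀ i : Fin 4, i = p ∨ i = q ∨ i = k ∨ i = k') →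
        (∀ a ∈ A1, a k = 0) → finrank K A1 ≤ 1 := by
      intro k k' hcov' hk
      have hle : A1 ≤ K ∙ (Pi.single k' 1 : Fin 4 → K) := by
        intro a ha
        rw [Submodule.mem_span_singleton]
        refine ⟨a k', ?_⟩
        funext i
        simp only [Pi.smul_apply, Pi.single_apply, smul_eq_mul, mul_ite, mul_one, mul_zero]
        by_cases hik : i = k'
        · subst hik
          rw [if_pos rfl]
        · rw [if_neg hik]
          symm
          rcases hcov' i with rfl | rfl | rfl | rfl
          · exact (hApq a ha).1
          · exact (hApq a ha).2
          · exact hk a ha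
          · exact absurd rfl hik
      calc finrank K A1 ≤ finrank K (K ∙ (Pi.single k' 1 : Fin 4 → K)) := Submodule.finrank_mono hle
        _ ≤ 1 := by rw [finrank_span_singleton (Pi.single_ne_zero_iff.2 one_ne_zero)]
    by_cases hall : ∀ a ∈ A1, a p' = 0
    · have := hle1 p' q' hcov hall
      omega
    · push Not at hall
      obtain ⟨a₀, ha₀, ha₀p⟩ := hall
      have hq' : ∀ a ∈ A1, a q' = 0 :=
        vanish_of_mul_vanish A1 (fun a => a p') (fun a => a q') (fun _ _ => rfl) (fun _ _ => rfl) hpp ha₀ ha₀p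
      have := hle1 q' p' (fun i => by rcases hcov i with h | h | h | h <;> simp [h]) hq'
      omega
  · -- `A2 ⊄ A1`: the `3`-space `A1 + K b` makes `A2 ⊥ c₀`
    obtain ⟨b, hb, hbA⟩ := Set.not_subset.1 hBA
    have hb0 : b ≠ 0 := fun h => hbA (h ▸ A1.zero_mem)
    set U : Submodule K (Fin 4 → K) := A1 ⊔ K ∙ b with hU_def
    have hU3 : finrank K U = 3 := by
      have h := Submodule.finrank_sup_add_finrank_inf_eq A1 (K ∙ b)
      have hinf : A1 ⊓ (K ∙ b) = ⊥ := by
        rw [eq_bot_iff]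
        intro x hx
        rw [Submodule.mem_bot]
        obtain ⟨hxA, hxb⟩ := Submodule.mem_inf.1 hx
        rw [Submodule.mem_span_singleton] at hxb
        obtain ⟨μ, rfl⟩ := hxb
        by_cases hμ : μ = 0
        · rw [hμ, zero_smul]
        · exact absurd (by
            have h' := A1.smul_mem μ⁻¹ hxA
            rwa [smul_smul, inv_mul_cancel₀ hμ, one_smul] at h') hbA
      rw [hinf, finrank_bot, add_zero, hn1, finrank_span_singleton hb0] at h
      rw [hU_def, h]
    have hperp : ∀ b' ∈ A2, PermOrth b' c₀ := by
      intro b' hb'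
      refine permOrth_of_T3_hyperplane U hU3 fun u hu l => ?_
      obtain ⟨a, ha, x, hx, rfl⟩ := Submodule.mem_sup.1 hu
      rw [Submodule.mem_span_singleton] at hx
      obtain ⟨μ, rfl⟩ := hx
      rw [T3_add₁, T3_smul₁, hT a ha b' hb', h5a' b' hb' b hb l, mul_zero, add_zero]
    have := finrank_le_one_of_permOrth A2 hc₀0 hperp
    omega

end Summit.ValiantsHypothesis.ValiantsHypothesis.Theorems.SymPencilPerFourOneRowToric
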